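import Summits.BirchSwinnertonDyer.BirchSwinnertonDyer.Theorems.ByReductionTypeAtTwoAdditivePotGoodPrintShuZhai84b1Base
import Summits.BirchSwinnertonDyer.BirchSwinnertonDyer.Theorems.ByReductionTypeAtTwoAdditivePotGoodPrintShuZhai84a1
import Literature.NumberTheory.EllipticCurves.ShuZhai2021.Table52AdditiveRows
import HarnessLib

/-!
# K4 crux `AdditiveRankZeroAtTwo` (19098), children C3″ (22617) / C2″ (22616): the SHU–ZHAI 2021 print road at the base `84b1` — file 2/2:
# THE ROAD — `BSD(·, 2)` (both K4 halves) at every global minimal `84b1^{(M)}` and `r_an = 1 ∧ BSD(·, 2)` at every global minimal `84b1^{(−47M)}`,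
# with the optimality datum and «`f([0]) ∉ 2E(ℚ)`» BY NAME from the printed §5.2 Table row (`ShuZhai2021.table52_row84b1`)

Cell `bsd-2adic`, seat `bsd-2adic-k4-w2` GEN 7 (prover, explicit unit, no kit); `--supports stmt-BirchSwinnertonDyer-22616 --as helper`
(cc C3″ 22617); twin of GEN 6's `…PrintShuZhai84a1.lean` (same Heegner prime `p = 47`, same admissible set, same `2`-division fields).
HONEST FRAMING (D-0036/D-0054): KERNEL (file 1 + §7): minimality, `ord₂ j = 14`, `Addv` of the unramified twists (`M ≡ 1 (mod 4)`),
the `2`-isogeny and (Tor), `N ∣ 336`, the Heegner field `ℚ(√−47)`; PRINT BY NAME: Shu–Zhai Thm. 1.2 + 1.4, Creutz–Miller (base `BSD(84b1, 2)`),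
Agashe–Ribet–Stein Thm. 2.6 (odd Manin constant), modularity, and (§9) the Table row `84b1`; DISPLAYED in §8: optimality datum, `f([0]) ∉ 2E(ℚ)`
(discharged by name in §9), `Q`, `hQM` (Shu–Zhai's conditions on the member). Closes nothing at the `∀`-level; nothing booked; BSD is not
proved by any of this.

References: [ShuZhai2021] Thm. 1.2, Thm. 1.4, §5.2 Table (row 84b1); [CreutzMiller2012] Thm. 1.1; [AgasheRibetStein2006] Thm. 2.6;
[Miller2011LMS] Def. 1.1; [SilvermanAEC2009] VII.5, X.5.
-/

set_option autoImplicit false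
set_option linter.dupNamespace false

noncomputable section

open scoped Classical

open Module NumberField WeierstrassCurve Literature.NumberTheory.EllipticCurves
  Literature.NumberTheory.EllipticCurves.ModularForms
  Literature.NumberTheory.EllipticCurves.Rank1Residual
  Literature.NumberTheory.EllipticCurves.Rank1Residual.Typed
  Literature.NumberTheory.EllipticCurves.ShuZhai2021
  Literature.NumberTheory.EllipticCurves.AgasheRibetStein2006
  Summit.BirchSwinnertonDyer
  Summit.BirchSwinnertonDyer.Rank1Residual
  Summit.BirchSwinnertonDyer.Rank1Residual.X5.O1
  Summit.BirchSwinnertonDyer.Rank1Residual.P2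
  Summit.BirchSwinnertonDyer.BirchSwinnertonDyer.Rank1Residual.IntModel
  Summit.BirchSwinnertonDyer.BirchSwinnertonDyer.Theorems

namespace Summit.BirchSwinnertonDyer.BirchSwinnertonDyer.Theorems.AddPotGoodPrint

/-! ## §6 The setting of Shu–Zhai Thm. 1.2 at `84b1` with `p = 47` -/

/-- **The setting `Thm12Setting` of Shu–Zhai Thm. 1.2 for `E = 84b1`, `E′ = [0,−10,0,−3,0]`, `p = 47`** — KERNEL: the `2`-isogeny of degree
`2`, (Tor) for `E` and `E′`, `47` prime `> 3`, `47 ≡ 3 (mod 4)`, the Heegner hypothesis for `(N, ℚ(√−47))`; DISPLAYED: the optimality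
datum (`hopt`), `f([0]) ∉ 2E(ℚ)` (`hcusp`) and the admissibility of the twisting primes (`hQ`, stated on the literal model of `E′`).
[cite: ShuZhai2021, Thm. 1.2 hypotheses and §5.2 Table (row 84b1)] -/
theorem thm12Setting_84b1
    [hN : haveI := isElliptic_84b1; NeZero ((⟨0, -1, 0, -1, -2⟩ : WeierstrassCurve ℚ).conductorNorm ℤ)]
    (Dt : haveI := isElliptic_84b1; ModularParametrizationData (⟨0, -1, 0, -1, -2⟩ : WeierstrassCurve ℚ)
      ((⟨0, -1, 0, -1, -2⟩ : WeierstrassCurve ℚ).conductorNorm ℤ))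
    (hopt : ∀ z ∈ Dt.L.lattice, ∃ w ∈ periodLattice Dt.f, z = Dt.c * w)
    (hcusp : haveI := isElliptic_84b1; CuspZeroNotInTwice (⟨0, -1, 0, -1, -2⟩ : WeierstrassCurve ℚ) Dt)
    (Q : Finset ℕ) (hQ : haveI := isElliptic_84b1;
      ∀ q ∈ Q, IsAdmissible (⟨0, -1, 0, -1, -2⟩ : WeierstrassCurve ℚ) (⟨0, -10, 0, -3, 0⟩ : WeierstrassCurve ℚ) q ∧ q ≠ 47) :
    haveI := isElliptic_84b1
    Thm12Setting (⟨0, -1, 0, -1, -2⟩ : WeierstrassCurve ℚ) Dt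
      (((⟨1, 2, 0, 0⟩ : VariableChange ℚ) • (⟨0, -1, 0, -1, -2⟩ : WeierstrassCurve ℚ)).twoIsogenyCodomain) 47 Q := by
  haveI := isElliptic_84b1
  refine ⟨exists_isogeny_degree_two_84b1, hopt, hcusp, natCard_twoTorsion_84b1, natCard_twoTorsion_twoIsogenyCodomain_84b1,
    by norm_num, by norm_num, by norm_num, ?_, ?_⟩
  · exact_mod_cast allPrimesSplitInSqrt_neg47_84b1.1
  · intro q hq
    rw [twoIsogenyCodomain_shift_84b1]
    exact hQ q hq

/-- **`r_an(84b1) = 0`** from Shu–Zhai Thm. 1.2 at `r = 0` (no record needed). [cite: ShuZhai2021, Thm. 1.2 (r = 0)] -/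
theorem analyticRank_84b1_of_shuZhai (h12 : thm12_ranks_of_twists)
    [hN : haveI := isElliptic_84b1; NeZero ((⟨0, -1, 0, -1, -2⟩ : WeierstrassCurve ℚ).conductorNorm ℤ)]
    (Dt : haveI := isElliptic_84b1; ModularParametrizationData (⟨0, -1, 0, -1, -2⟩ : WeierstrassCurve ℚ)
      ((⟨0, -1, 0, -1, -2⟩ : WeierstrassCurve ℚ).conductorNorm ℤ))
    (hopt : ∀ z ∈ Dt.L.lattice, ∃ w ∈ periodLattice Dt.f, z = Dt.c * w)
    (hcusp : haveI := isElliptic_84b1; CuspZeroNotInTwice (⟨0, -1, 0, -1, -2⟩ : WeierstrassCurve ℚ) Dt) :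
    haveI := isElliptic_84b1
    (⟨0, -1, 0, -1, -2⟩ : WeierstrassCurve ℚ).analyticRank = 0 := by
  haveI := isElliptic_84b1; haveI := isGloballyMinimal_84b1
  exact (base_rankZero_of_shuZhai h12 (thm12Setting_84b1 Dt hopt hcusp ∅ (fun q hq => absurd hq (Finset.notMem_empty q)))).1

/-- **`BSD(84b1, p)` for every prime `p` BY PRINT** (Creutz–Miller Thm. 1.1: `N(84b1) ∣ 336 < 5000` in the kernel, `r_an = 0`).
[cite: CreutzMiller2012, Thm. 1.1] [cite: Miller2011LMS, Def. 1.1] -/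
theorem bsdp_84b1_print (hCM : bsdTriple_of_analyticRank_le_one_of_conductor_lt)
    (hr : haveI := isElliptic_84b1; (⟨0, -1, 0, -1, -2⟩ : WeierstrassCurve ℚ).analyticRank = 0) {p : ℕ} (hp : p.Prime) :
    haveI := isElliptic_84b1; BSDp (⟨0, -1, 0, -1, -2⟩ : WeierstrassCurve ℚ) p := by
  haveI := isElliptic_84b1; haveI := isGloballyMinimal_84b1
  have hlt : (⟨0, -1, 0, -1, -2⟩ : WeierstrassCurve ℚ).conductorNorm ℤ < 5000 :=
    lt_of_le_of_lt (Nat.le_of_dvd (by norm_num) conductorNorm_dvd_336_84b1) (by norm_num)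
  exact forall_bsdp_of_bsdTriple _ (WeierstrassCurve.tamagawaProduct_pos_holds _) (hCM _ (by omega) hlt) p hp

/-! ## §7 The K4 habitat of `84b1` and of its twists by `d ≡ 1 (mod 4)` -/

/-- **`84b1` is ADDITIVE at `2`** (`2 ∣ Δ`, `2 ∣ c₄` on the minimal integer equation). [cite: SilvermanAEC2009, VII.5 Prop. 5.1 (c)] -/
theorem addv_two_84b1 :
    haveI := isElliptic_84b1; haveI := isGloballyMinimal_84b1; haveI : Fact (Nat.Prime 2) := ⟨Nat.prime_two⟩
    Addv (⟨0, -1, 0, -1, -2⟩ : WeierstrassCurve ℚ) 2 := by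
  haveI : Fact (Nat.Prime 2) := ⟨Nat.prime_two⟩
  haveI := isElliptic_84b1; haveI := isGloballyMinimal_84b1
  exact Additive.addv_of_intModel intModel_84b1 2 (by rw [M84b1_Δ]; decide) (by rw [M84b1_c₄]; decide)

/-- **HABITAT of every global minimal twist of `84b1` by `d ≡ 1 (mod 4)`**: ADDITIVE and POTENTIALLY GOOD at `2` (unramified twist,
`ord₂ j = 14 ≥ 0`), NON-CM (`j(84b1)` is not a CM invariant), `W[2]` REDUCIBLE (the rational `2`-torsion point persists).
[cite: SilvermanAEC2009, VII.5 and X.5] -/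
theorem habitat_twist_84b1 {d : ℤ} (hd4 : d % 4 = 1) (hd0 : d ≠ 0) (W : WeierstrassCurve ℚ) [W.IsElliptic] [W.IsGloballyMinimal]
    (hW : ∃ C : VariableChange ℚ, C • (⟨0, -1, 0, -1, -2⟩ : WeierstrassCurve ℚ).quadraticTwist (d : ℚ) = W) :
    haveI : Fact (Nat.Prime 2) := ⟨Nat.prime_two⟩
    Addv W 2 ∧ 0 ≤ padicValRat 2 W.j ∧ ¬ W.HasCM ∧ Red W 2 := by
  haveI : Fact (Nat.Prime 2) := ⟨Nat.prime_two⟩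
  haveI := isElliptic_84b1; haveI := isGloballyMinimal_84b1
  have hdq : (d : ℚ) ≠ 0 := by exact_mod_cast hd0
  haveI := (⟨0, -1, 0, -1, -2⟩ : WeierstrassCurve ℚ).isElliptic_quadraticTwist hdq
  obtain ⟨hA, hJ⟩ := addv_two_of_smul_quadraticTwist_of_emod_four_eq_one _ addv_two_84b1
    (by rw [padicValRat_j_84b1]; norm_num) hd4 hd0 W hW
  have hred : Red W 2 := fun hirr => red_two_84b1 ((irr_two_iff_of_twist _ hdq hW).mpr hirr)
  have hjW : W.j = (⟨0, -1, 0, -1, -2⟩ : WeierstrassCurve ℚ).j := by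
    obtain ⟨C, rfl⟩ := hW
    rw [variableChange_j, j_quadraticTwist _ hdq]
  refine ⟨hA, hJ, fun hW' => not_hasCM_84b1 ?_, hred⟩
  exact (WeierstrassCurve.hasCM_iff_j_mem_holds _).mpr (hjW ▸ (WeierstrassCurve.hasCM_iff_j_mem_holds W).mp hW')

/-! ## §8 THE ROAD: BSD₂ at every global minimal model of `84b1^{(M)}` and of `84b1^{(−47M)}` -/

/-- **THE SHU–ZHAI PRINT ROAD AT `84b1`.** For every finite set `Q` of admissible primes (`≠ 47`) with «every `ℓ ∣ 2N` splits in
`ℚ(√M)`», `M = ∏_{q∈Q} q*`, and every global minimal `W ≅ 84b1^{(M)}`: `r_an(W) = 0`, `W` ADDITIVE and POTENTIALLY GOOD at `2`, NON-CM,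
`W[2]` REDUCIBLE, `BSD(W, 2)` and BOTH K4 halves `MissingLowerBoundAt W 2`, `MissingUpperBoundAt W 2`. KERNEL (file 1 + §7): minimality,
`ord₂ j = 14`, `Addv` of the unramified twists, the `2`-isogeny and (Tor), `N ∣ 336`, the Heegner field `ℚ(√−47)`; PRINT BY NAME: Shu–Zhai Thm. 1.2 + 1.4, Creutz–Miller
(base `BSD(84b1, 2)`), Agashe–Ribet–Stein Thm. 2.6 (odd Manin constant), modularity; DISPLAYED: optimality datum, `f([0]) ∉ 2E(ℚ)`,
`Q`, `hQM`. BSD is not proved by any of this.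
[cite: ShuZhai2021, Thm. 1.2 and Thm. 1.4] [cite: CreutzMiller2012, Thm. 1.1] [cite: AgasheRibetStein2006, Thm. 2.6] [cite: Miller2011LMS, Def. 1.1] -/
theorem printFamily84b1_of_shuZhai (h12 : thm12_ranks_of_twists) (h14 : thm14_twoPartBSD_of_twists)
    (h26 : cremona_abs_maninConstant_eq_one_of_level_le) (hCM : bsdTriple_of_analyticRank_le_one_of_conductor_lt)
    (hmod : hasEntireLFunction_rat)
    [hN : haveI := isElliptic_84b1; NeZero ((⟨0, -1, 0, -1, -2⟩ : WeierstrassCurve ℚ).conductorNorm ℤ)]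
    (Dt : haveI := isElliptic_84b1; ModularParametrizationData (⟨0, -1, 0, -1, -2⟩ : WeierstrassCurve ℚ)
      ((⟨0, -1, 0, -1, -2⟩ : WeierstrassCurve ℚ).conductorNorm ℤ))
    (hopt : ∀ z ∈ Dt.L.lattice, ∃ w ∈ periodLattice Dt.f, z = Dt.c * w)
    (hcusp : haveI := isElliptic_84b1; CuspZeroNotInTwice (⟨0, -1, 0, -1, -2⟩ : WeierstrassCurve ℚ) Dt)
    (Q : Finset ℕ) (hQ : haveI := isElliptic_84b1;
      ∀ q ∈ Q, IsAdmissible (⟨0, -1, 0, -1, -2⟩ : WeierstrassCurve ℚ) (⟨0, -10, 0, -3, 0⟩ : WeierstrassCurve ℚ) q ∧ q ≠ 47)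
    (hQM : haveI := isElliptic_84b1;
      AllPrimesSplitInSqrt (2 * (⟨0, -1, 0, -1, -2⟩ : WeierstrassCurve ℚ).conductorNorm ℤ) (∏ q ∈ Q, qStar q))
    (W : WeierstrassCurve ℚ) [W.IsElliptic] [W.IsGloballyMinimal]
    (hW : ∃ C : VariableChange ℚ, C • (⟨0, -1, 0, -1, -2⟩ : WeierstrassCurve ℚ).quadraticTwist ((∏ q ∈ Q, qStar q : ℤ) : ℚ) = W) :
    haveI : Fact (Nat.Prime 2) := ⟨Nat.prime_two⟩
    W.analyticRank = 0 ∧ Addv W 2 ∧ 0 ≤ padicValRat 2 W.j ∧ ¬ W.HasCM ∧ Red W 2 ∧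
      BSDp W 2 ∧ MissingLowerBoundAt W 2 ∧ MissingUpperBoundAt W 2 := by
  haveI : Fact (Nat.Prime 2) := ⟨Nat.prime_two⟩
  haveI := isElliptic_84b1; haveI := isGloballyMinimal_84b1
  have hS := thm12Setting_84b1 Dt hopt hcusp Q hQ
  -- the companion twist by `−47·M` (a global minimal model exists; its conclusions are dropped here)
  have hQ0 : ∀ q ∈ Q, (q : ℤ) ≠ 0 := fun q hq => by exact_mod_cast (hQ q hq).1.1.ne_zero
  have hd : ((-(47 : ℕ) * ∏ q ∈ Q, qStar q : ℤ) : ℚ) ≠ 0 := neg_p_mul_ne_zero_of_thm12Setting hS Q hQ0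
  obtain ⟨WpM, _, _, hpM⟩ := exists_globallyMinimal_twist (⟨0, -1, 0, -1, -2⟩ : WeierstrassCurve ℚ) hd
  -- odd Manin constant by print, base `BSD(84b1, 2)` by print
  have hc : ¬ (2 : ℤ) ∣ Dt.c := not_two_dvd_c_of_level_le h26 _ Dt hopt
    (le_trans (Nat.le_of_dvd (by norm_num) conductorNorm_dvd_336_84b1) (by norm_num))
  have hbase : BSDp (⟨0, -1, 0, -1, -2⟩ : WeierstrassCurve ℚ) 2 :=
    bsdp_84b1_print hCM (analyticRank_84b1_of_shuZhai h12 Dt hopt hcusp) Nat.prime_two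
  obtain ⟨⟨hr, hB⟩, -⟩ := bsdp_two_twists_of_shuZhai h12 h14 hmod hS hW hpM hc
    (by exact_mod_cast allPrimesSplitInSqrt_neg47_84b1.2) hQM hbase
  -- the halves from `BSD(W, 2)` (`Ш(W)` finite by Thm. 1.2)
  obtain ⟨-, -, -, -, hfin, -⟩ := h12 _ Dt _ 47 Q hS W WpM hW hpM
  haveI := hfin
  have hLU := lower_and_upper_of_missingPPartAt W 2 (missingPPartAt_of_bsdp W 2 hB)
  -- the habitat (`M ≡ 1 (mod 4)`: unramified twist)
  have hM0 : (∏ q ∈ Q, qStar q : ℤ) ≠ 0 := by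
    rw [Finset.prod_ne_zero_iff]; intro q hq; unfold qStar; split_ifs
    · exact hQ0 q hq
    · exact neg_ne_zero.mpr (hQ0 q hq)
  have hM4 : (∏ q ∈ Q, qStar q) % 4 = 1 := prod_qStar_emod_four_eq_one Q fun q hq => mod_two_eq_one_of_isAdmissible (hQ q hq).1
  obtain ⟨hadd, hj, hcm, hred⟩ := habitat_twist_84b1 hM4 hM0 W hW
  exact ⟨hr, hadd, hj, hcm, hred, hB, hLU.1, hLU.2⟩

/-- **THE RANK-ONE COMPANION FAMILY `84b1^{(−47M)}`** (same data): at every global minimal `W₁ ≅ 84b1^{(−47·M)}`: `r_an(W₁) = 1`, `W₁` is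
ADDITIVE and POTENTIALLY GOOD at `2` (`−47M ≡ 1 (mod 4)`: unramified twist), NON-CM, `W₁[2]` REDUCIBLE, and `BSD(W₁, 2)` holds — a
print-decided RANK-ONE additive family (bears on K4's `RankOneAtTwo` children; recorded, not this seat's item). Inputs as above.
BSD is not proved by any of this. [cite: ShuZhai2021, Thm. 1.2 and Thm. 1.4] [cite: CreutzMiller2012, Thm. 1.1] [cite: Miller2011LMS, Def. 1.1] -/
theorem printFamily84b1_rankOne_of_shuZhai (h12 : thm12_ranks_of_twists) (h14 : thm14_twoPartBSD_of_twists)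
    (h26 : cremona_abs_maninConstant_eq_one_of_level_le) (hCM : bsdTriple_of_analyticRank_le_one_of_conductor_lt)
    (hmod : hasEntireLFunction_rat)
    [hN : haveI := isElliptic_84b1; NeZero ((⟨0, -1, 0, -1, -2⟩ : WeierstrassCurve ℚ).conductorNorm ℤ)]
    (Dt : haveI := isElliptic_84b1; ModularParametrizationData (⟨0, -1, 0, -1, -2⟩ : WeierstrassCurve ℚ)
      ((⟨0, -1, 0, -1, -2⟩ : WeierstrassCurve ℚ).conductorNorm ℤ))
    (hopt : ∀ z ∈ Dt.L.lattice, ∃ w ∈ periodLattice Dt.f, z = Dt.c * w)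
    (hcusp : haveI := isElliptic_84b1; CuspZeroNotInTwice (⟨0, -1, 0, -1, -2⟩ : WeierstrassCurve ℚ) Dt)
    (Q : Finset ℕ) (hQ : haveI := isElliptic_84b1;
      ∀ q ∈ Q, IsAdmissible (⟨0, -1, 0, -1, -2⟩ : WeierstrassCurve ℚ) (⟨0, -10, 0, -3, 0⟩ : WeierstrassCurve ℚ) q ∧ q ≠ 47)
    (hQM : haveI := isElliptic_84b1;
      AllPrimesSplitInSqrt (2 * (⟨0, -1, 0, -1, -2⟩ : WeierstrassCurve ℚ).conductorNorm ℤ) (∏ q ∈ Q, qStar q))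
    (W₁ : WeierstrassCurve ℚ) [W₁.IsElliptic] [W₁.IsGloballyMinimal]
    (hW₁ : ∃ C : VariableChange ℚ,
      C • (⟨0, -1, 0, -1, -2⟩ : WeierstrassCurve ℚ).quadraticTwist ((-(47 : ℕ) * ∏ q ∈ Q, qStar q : ℤ) : ℚ) = W₁) :
    haveI : Fact (Nat.Prime 2) := ⟨Nat.prime_two⟩
    W₁.analyticRank = 1 ∧ Addv W₁ 2 ∧ 0 ≤ padicValRat 2 W₁.j ∧ ¬ W₁.HasCM ∧ Red W₁ 2 ∧ BSDp W₁ 2 := by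
  haveI : Fact (Nat.Prime 2) := ⟨Nat.prime_two⟩
  haveI := isElliptic_84b1; haveI := isGloballyMinimal_84b1
  have hS := thm12Setting_84b1 Dt hopt hcusp Q hQ
  have hQ0 : ∀ q ∈ Q, (q : ℤ) ≠ 0 := fun q hq => by exact_mod_cast (hQ q hq).1.1.ne_zero
  have hd : ((-(47 : ℕ) * ∏ q ∈ Q, qStar q : ℤ) : ℚ) ≠ 0 := neg_p_mul_ne_zero_of_thm12Setting hS Q hQ0
  -- a global minimal model of the rank-`0` twist `84b1^{(M)}` (its conclusions are dropped here)
  have hM0 : ((∏ q ∈ Q, qStar q : ℤ) : ℚ) ≠ 0 := by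
    have : (∏ q ∈ Q, qStar q : ℤ) ≠ 0 := by
      rw [Finset.prod_ne_zero_iff]; intro q hq; unfold qStar; split_ifs
      · exact hQ0 q hq
      · exact neg_ne_zero.mpr (hQ0 q hq)
    exact_mod_cast this
  obtain ⟨WM, _, _, hM⟩ := exists_globallyMinimal_twist (⟨0, -1, 0, -1, -2⟩ : WeierstrassCurve ℚ) hM0
  have hc : ¬ (2 : ℤ) ∣ Dt.c := not_two_dvd_c_of_level_le h26 _ Dt hopt
    (le_trans (Nat.le_of_dvd (by norm_num) conductorNorm_dvd_336_84b1) (by norm_num))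
  have hbase : BSDp (⟨0, -1, 0, -1, -2⟩ : WeierstrassCurve ℚ) 2 :=
    bsdp_84b1_print hCM (analyticRank_84b1_of_shuZhai h12 Dt hopt hcusp) Nat.prime_two
  obtain ⟨-, hr1, hB1⟩ := bsdp_two_twists_of_shuZhai h12 h14 hmod hS hM hW₁ hc
    (by exact_mod_cast allPrimesSplitInSqrt_neg47_84b1.2) hQM hbase
  -- the habitat (`−47·M ≡ 1 (mod 4)`: unramified twist)
  have hdZ : (-(47 : ℕ) * ∏ q ∈ Q, qStar q : ℤ) ≠ 0 := by exact_mod_cast hd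
  have hd4 : (-(47 : ℕ) * ∏ q ∈ Q, qStar q : ℤ) % 4 = 1 := by
    rw [Int.mul_emod, prod_qStar_emod_four_eq_one Q fun q hq => mod_two_eq_one_of_isAdmissible (hQ q hq).1]; norm_num
  obtain ⟨hadd, hj, hcm, hred⟩ := habitat_twist_84b1 hd4 hdZ W₁ hW₁
  exact ⟨hr1, hadd, hj, hcm, hred, hB1⟩

/-! ## §9 The optimality datum and «`f([0]) ∉ 2E(ℚ)`» BY NAME from the printed Table row `84b1` -/

/-- **THE SHU–ZHAI ROAD AT `84b1`, BY NAME from the §5.2 Table row** (`ShuZhai2021.table52_row84b1`: optimal datum + `f([0]) ∉ 2E(ℚ)`):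
for every finite set `Q` of admissible primes (`≠ 47`) with «every `ℓ ∣ 2N` splits in `ℚ(√M)`», `M = ∏ q*`, and every global minimal
`W ≅ 84b1^{(M)}`: `r_an(W) = 0 ∧ Addv W 2 ∧ 0 ≤ ord₂ j(W) ∧ ¬CM ∧ Red W 2 ∧ BSD(W, 2) ∧ MissingLowerBoundAt W 2 ∧ MissingUpperBoundAt W 2`.
No displayed base datum. BSD is not proved by any of this.
[cite: ShuZhai2021, Thm. 1.2, Thm. 1.4 and §5.2 Table (row 84b1)] [cite: CreutzMiller2012, Thm. 1.1] [cite: AgasheRibetStein2006, Thm. 2.6] [cite: Miller2011LMS, Def. 1.1] -/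
theorem printFamily84b1_of_shuZhai_of_table52 (h12 : thm12_ranks_of_twists) (h14 : thm14_twoPartBSD_of_twists)
    (htab : table52_row84b1) (h26 : cremona_abs_maninConstant_eq_one_of_level_le) (hCM : bsdTriple_of_analyticRank_le_one_of_conductor_lt)
    (hmod : hasEntireLFunction_rat)
    (Q : Finset ℕ) (hQ : haveI := isElliptic_84b1;
      ∀ q ∈ Q, IsAdmissible (⟨0, -1, 0, -1, -2⟩ : WeierstrassCurve ℚ) (⟨0, -10, 0, -3, 0⟩ : WeierstrassCurve ℚ) q ∧ q ≠ 47)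
    (hQM : haveI := isElliptic_84b1;
      AllPrimesSplitInSqrt (2 * (⟨0, -1, 0, -1, -2⟩ : WeierstrassCurve ℚ).conductorNorm ℤ) (∏ q ∈ Q, qStar q))
    (W : WeierstrassCurve ℚ) [W.IsElliptic] [W.IsGloballyMinimal]
    (hW : ∃ C : VariableChange ℚ, C • (⟨0, -1, 0, -1, -2⟩ : WeierstrassCurve ℚ).quadraticTwist ((∏ q ∈ Q, qStar q : ℤ) : ℚ) = W) :
    haveI : Fact (Nat.Prime 2) := ⟨Nat.prime_two⟩
    W.analyticRank = 0 ∧ Addv W 2 ∧ 0 ≤ padicValRat 2 W.j ∧ ¬ W.HasCM ∧ Red W 2 ∧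
      BSDp W 2 ∧ MissingLowerBoundAt W 2 ∧ MissingUpperBoundAt W 2 := by
  obtain ⟨hN, Dt, hopt, hcusp⟩ := htab
  haveI := hN
  exact printFamily84b1_of_shuZhai h12 h14 h26 hCM hmod Dt hopt hcusp Q hQ hQM W hW

/-- **THE RANK-ONE COMPANIONS `84b1^{(−47M)}`, BY NAME from the Table row.** BSD is not proved by any of this.
[cite: ShuZhai2021, Thm. 1.2, Thm. 1.4 and §5.2 Table (row 84b1)] [cite: CreutzMiller2012, Thm. 1.1] [cite: Miller2011LMS, Def. 1.1] -/
theorem printFamily84b1_rankOne_of_shuZhai_of_table52 (h12 : thm12_ranks_of_twists) (h14 : thm14_twoPartBSD_of_twists)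
    (htab : table52_row84b1) (h26 : cremona_abs_maninConstant_eq_one_of_level_le) (hCM : bsdTriple_of_analyticRank_le_one_of_conductor_lt)
    (hmod : hasEntireLFunction_rat)
    (Q : Finset ℕ) (hQ : haveI := isElliptic_84b1;
      ∀ q ∈ Q, IsAdmissible (⟨0, -1, 0, -1, -2⟩ : WeierstrassCurve ℚ) (⟨0, -10, 0, -3, 0⟩ : WeierstrassCurve ℚ) q ∧ q ≠ 47)
    (hQM : haveI := isElliptic_84b1;
      AllPrimesSplitInSqrt (2 * (⟨0, -1, 0, -1, -2⟩ : WeierstrassCurve ℚ).conductorNorm ℤ) (∏ q ∈ Q, qStar q))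
    (W₁ : WeierstrassCurve ℚ) [W₁.IsElliptic] [W₁.IsGloballyMinimal]
    (hW₁ : ∃ C : VariableChange ℚ,
      C • (⟨0, -1, 0, -1, -2⟩ : WeierstrassCurve ℚ).quadraticTwist ((-(47 : ℕ) * ∏ q ∈ Q, qStar q : ℤ) : ℚ) = W₁) :
    haveI : Fact (Nat.Prime 2) := ⟨Nat.prime_two⟩
    W₁.analyticRank = 1 ∧ Addv W₁ 2 ∧ 0 ≤ padicValRat 2 W₁.j ∧ ¬ W₁.HasCM ∧ Red W₁ 2 ∧ BSDp W₁ 2 := by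
  obtain ⟨hN, Dt, hopt, hcusp⟩ := htab
  haveI := hN
  exact printFamily84b1_rankOne_of_shuZhai h12 h14 h26 hCM hmod Dt hopt hcusp Q hQ hQM W₁ hW₁

end Summit.BirchSwinnertonDyer.BirchSwinnertonDyer.Theorems.AddPotGoodPrint

end
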